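import Mathlib
import Summits.Ventures.HodgeRepro.OcticCMPointTruncModel
import Summits.Ventures.HodgeRepro.OcticCMPointDeepSign

/-!
# OcticCMPointTruncSign — `ε(½, ω, ψ_δ) = ±1` and (E3) by stability on `𝒪/𝔭^c`, `2 ≤ c ≤ 4`, at `𝔭₁, 𝔭₂ | 5`

Blind re-derivation cell `pub-hodge-repro`, seat night-2 (gen 4).  Target tree path
`lean/Summits/Ventures/HodgeRepro/OcticCMPointTruncSign.lean`.  Composes `OcticCMPointTruncModel.lean` (the
transcribed ring `Trunc k c = k[ϖ]/(ϖ^c)` with its `hloc`, `hA`, `hsq`, primitive `ψ̃`, conjugation `σ`) with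
gen 3's `OcticCMPointDeepSign.lean` (the product formula `eps_eq_one_or_neg_one_local` on a finite local ring),
`OcticCMPointConjDual.lean` (`conjDual_ramified`) and `OcticCMPointKappa.lean` (`kappaHalf`).

* **`eps_sign_trunc`** — for a conjugate-dual character `ω` of conductor EXACTLY `c` at `𝔭 | 5` (`ω ∘ σ = ω⁻¹`,
  `ω` non-trivial on `1 + A`, `ω(ϖ)² = ω(−1)` for the trace-zero `ϖ`, `ω(ϖ) ≠ 0`), `n = ν + c ≡ c (mod 2)`, and
  Kudla's `s = ½` constant `κ = |R|^{−1/2}`: `ε(½, ω, ψ̃) ∈ {1, −1}` — ROUTE-B §9.9 (f) (`ε_𝔮(½, ν♭, ψ_δ) = ±1`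
  for every conjugate-dual `ν♭`, on Kudla (3.29)) with NO model hypothesis left, at every conductor `2 ≤ c ≤ 4`
  of the ramified places of the octic point;
* (E3) by stability on the same ring — `E3_of_N2_trunc` — lives in `OcticCMPointTruncModel.lean`.

**What this is not.**  The conductor, conjugate duality and `ϖ`-value of the actual `χ′_j` of the octic face
(on no page) stay hypotheses; `c ≥ 5` and the place `𝔮 | 2` are not covered.  Nothing
here says anything about the status of the Hodge conjecture for CM abelian varieties, which is NOT proved.
-/

set_option autoImplicit false

noncomputable section

open Finset Polynomial

namespace Summit.Ventures.HodgeRepro.PeriodCloser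

open GaussSumStability

namespace TruncModel

variable {k : Type} [Field k] (c : ℕ)

/-- **`ε(½, ω, ψ_δ) = ±1` at `𝔭₁, 𝔭₂ | 5` for every conductor `2 ≤ c ≤ 4`** — the product formula of
`OcticCMPointDeepSign.lean` on the transcribed ring, with `hloc`, `hA`, `hsq`, the primitivity of `ψ̃` and the
conjugation supplied by `OcticCMPointTruncModel.lean`; the hypotheses left are intrinsic to `ω`: conductor
exactly `c` (`hprim`), `ω(ϖ) ≠ 0`, conjugate duality `ω ∘ σ = ω⁻¹`, `ω(ϖ)² = ω(−1)`, and `n ≡ c (mod 2)`. -/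
theorem eps_sign_trunc [Fintype k] (hc : 2 ≤ c) (ψ₀ : AddChar k ℂ) (h₀ : ψ₀.IsPrimitive) (ω : LocalChar (Trunc k c))
    (hprim : ∃ z₀, PsiAnn (psiTilde c ψ₀) (maxIdeal c) z₀ ∧ ω.unit (1 + z₀) ≠ 1) (hπ : ω.piVal ≠ 0)
    (hσω : ∀ x, ω.unit (conj c x) = ω.unit⁻¹ x) (hπ2 : ω.piVal ^ 2 = ω.unit (-1)) (n : ℕ)
    (hn : n % 2 = c % 2) :
    LocalChar.eps (LocalChar.kappaHalf (Trunc k c)) n ω (psiTilde c ψ₀) = 1 ∨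
      LocalChar.eps (LocalChar.kappaHalf (Trunc k c)) n ω (psiTilde c ψ₀) = -1 := by
  haveI : Nonempty (Trunc k c) := ⟨0⟩
  exact LocalChar.eps_eq_one_or_neg_one_local (LocalChar.kappaHalf (Trunc k c)) n ω (psiTilde c ψ₀)
    (psiTilde_isPrimitive c (by omega) ψ₀ h₀) (maxIdeal c) (hloc c (by omega)) (hA c hc ψ₀ h₀)
    (hsq c hc ψ₀ h₀) hprim hπ (LocalChar.kappaHalf_sq_mul_card (Trunc k c))
    (LocalChar.conjDual_ramified _ n ω (psiTilde c ψ₀) (conj c) (psiTilde_conj_pow c (by omega) ψ₀ n hn)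
      hσω hπ2)

/-- **At `𝔭₁, 𝔭₂ | 5` in numbers**: the same with `k = 𝔽₅`, `κ = 5^{−c/2}` (`kappaHalf`, `|R| = 5^c`). -/
theorem eps_sign_trunc_p5 (hc : 2 ≤ c) (ψ₀ : AddChar (ZMod 5) ℂ) (h₀ : ψ₀.IsPrimitive)
    (ω : LocalChar (Trunc (ZMod 5) c))
    (hprim : ∃ z₀, PsiAnn (psiTilde c ψ₀) (maxIdeal c) z₀ ∧ ω.unit (1 + z₀) ≠ 1) (hπ : ω.piVal ≠ 0)
    (hσω : ∀ x, ω.unit (conj c x) = ω.unit⁻¹ x) (hπ2 : ω.piVal ^ 2 = ω.unit (-1)) (n : ℕ)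
    (hn : n % 2 = c % 2) :
    LocalChar.eps (LocalChar.kappaHalf (Trunc (ZMod 5) c)) n ω (psiTilde c ψ₀) = 1 ∨
      LocalChar.eps (LocalChar.kappaHalf (Trunc (ZMod 5) c)) n ω (psiTilde c ψ₀) = -1 :=
  eps_sign_trunc c hc ψ₀ h₀ ω hprim hπ hσω hπ2 n hn

end TruncModel

end Summit.Ventures.HodgeRepro.PeriodCloser

end
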